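import Summits.BirchSwinnertonDyer.Rank1Residual.Iwasawa.DatumSelmerNonPrimitiveInvariants
import Summits.BirchSwinnertonDyer.Rank1Residual.AdditivePotMult.MuLambdaTransferRamifiedOrdinaryOfRecords
import HarnessLib

/-!
# `Sel^{Σ₀}_E(ℚ_∞)_p` is cofinitely generated and `Λ`-cotorsion with `μ(X^{Σ₀}) = μ(X)` as soon as
# `Sel_{p^∞}(E/ℚ_∞)` is — conclusions 1–3 of `record_consequences_of_eq` WITHOUT the record `h23`
# (classical currency of row T-GV23-PA's kernel theorem; conclusions 4–5 NOT claimed)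

HONEST FRAMING (cell `b2b-bsdres`, run/shared/lean/b2b/bsd-rank1-residual/, verbatim in every
file): the goal of the cell is to DELETE the COMBINATION-SHAPED residual classes of the
Birch–Swinnerton-Dyer formula for ALL analytic-rank `≤ 1` elliptic curves over `ℚ` — "full BSD
formula for every rank `≤ 1` curve in class `C`" assembled STRICTLY from published theorems — so
that the rank-`≤ 1` remainder becomes exactly the CONSTRUCTION-SHAPED classes, which are TYPED
(missing-input `Prop`s), NOT attempted. This is not "finishing BSD". Team n1011 (N10/N11; row
T-GV23-PA = the located gap P-α of the A240 derivation): research routes on CONSTRUCTION-SHAPED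
classes; prove what is provable now; no claim beyond stated classes; census output = EVIDENCE,
never a Literature fact; RESIDUAL-MAP marks UNCHANGED; nothing is booked by this file. TOOL
THEOREMS ONLY: no definition, no named fact; no cited record enters as a hypothesis. APPENDED
consumer (referee-1 ACK-1 proviso (iv)): the `h23`-based `record_consequences_of_eq` of
`MuLambdaTransferRamifiedOrdinaryOfRecords` (K4) stays as it is; this file adds the record-free form
of its conclusions 1–3.

## What

For `E/ℚ`, a prime `p`, the CYCLOTOMIC `ℤ_p`-extension `κ` with topological generator `γ`, Greenberg
data `Lf` for `A = E[p^∞]`, a finite set `Σ₀ ∌ p` of places, and the subgroup identities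
`Sel_{p^∞}(E/ℚ_∞) = S_A(ℚ_∞)` (`hSel`) and `Sel^{Σ₀}_E(ℚ_∞)_p = S^{Σ₀}_A(ℚ_∞)` (`hNP`) — the
R-D identifications of p06's T-A240-PORT, exactly the binders of K4's `record_consequences_of_eq` —
and any Pontryagin-dual data `D` of `Sel` (finitely generated, TORSION) and `DS` of `Sel^{Σ₀}`:

* **`nonPrimitive_moduleFinite_isTorsion_mu_eq_of_eq`**: `DS.X` is finitely generated and
  `Λ`-torsion, `μ(DS.X) = μ(D.X)`, and `λ(D.X) ≤ λ(DS.X)` — from the kernel theorem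
  `datumSelmer_nonPrimitive_moduleFinite_isTorsion_mu_eq_of_isCyclotomic` (row T-GV23-PA) through
  K4's transports `exists_datumDualData_of_{selmerDualData, nonPrimitiveDualData}`; compared with
  `record_consequences_of_eq`: NO `h23`, NO `p ≠ 2`, NO ramified-line hypothesis `hLf`, NO
  `p ∤ #E(ℚ)_tors`.

GV 2000 Cor. (2.3) (arXiv:math/9906215 pp. 20–21), first clauses. NOT claimed: the `λ`-shift
`λ(DS) = λ(D) + Σ δ(E,v)` and the `p`-divisibility of `Sel^{Σ₀}/Sel` (conclusions 4–5; GV Prop.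
(2.1)/(2.4), still `h23`'s content).

References: R. Greenberg, V. Vatsal, Invent. Math. 142 (2000) §2 pp. 20–22.
-/

set_option autoImplicit false

noncomputable section

open scoped Classical NumberField AddSubgroup

open NumberField IsDedekindDomain Field WeierstrassCurve
  Literature.NumberTheory.GaloisRepresentations Literature.NumberTheory.EllipticCurves
  Literature.NumberTheory.EllipticCurves.GreenbergSelmer
  Literature.NumberTheory.EllipticCurves.GreenbergVatsal2000
  Summit.BirchSwinnertonDyer.Rank1Residual.X2.NonPrimitiveSelmerDual
  Summit.BirchSwinnertonDyer.Rank1Residual.Iwasawa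

namespace Summit.BirchSwinnertonDyer.Rank1Residual.Additive

variable {p : ℕ} [hp : Fact p.Prime] {W : WeierstrassCurve ℚ} [W.IsElliptic]
  {κ : ZpExtension ℚ p} {γ : absoluteGaloisGroup ℚ}

/-- **`Sel^{Σ₀}` cofinitely generated and `Λ`-cotorsion with `μ(X^{Σ₀}) = μ(X)` (and
`λ(X) ≤ λ(X^{Σ₀})`), WITHOUT the T-GV23L record.** For `E/ℚ`, the cyclotomic `ℤ_p`-extension with
topological generator `γ`, Greenberg data `Lf` for `E[p^∞]`, a finset `Σ₀ ∌ p`, the identifications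
`Sel = S_A(ℚ_∞)` (`hSel`) and `Sel^{Σ₀} = S^{Σ₀}_A(ℚ_∞)` (`hNP`), a finitely generated TORSION dual
datum `D` of `Sel` and any dual datum `DS` of `Sel^{Σ₀}`: `DS.X` is finitely generated and torsion,
`μ(DS.X) = μ(D.X)`, `λ(D.X) ≤ λ(DS.X)`. Conclusions 1–3 of K4's `record_consequences_of_eq`, now
from the kernel theorem `datumSelmer_nonPrimitive_moduleFinite_isTorsion_mu_eq_of_isCyclotomic`
(row T-GV23-PA) — no `h23`, no `p ≠ 2`, no `hLf`, no `p ∤ #E(ℚ)_tors`. GV 2000 Cor. (2.3), first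
clauses; conclusions 4–5 (`λ`-shift, divisibility) NOT claimed.
[cite: GreenbergVatsal2000, §2 Cor. (2.3) (arXiv:math/9906215 pp. 20–21)] -/
theorem nonPrimitive_moduleFinite_isTorsion_mu_eq_of_eq (hκ : κ.IsCyclotomic)
    (hγ : κ.IsTopGenerator γ) (Lf : Data ℚ (W.geomPrimaryTorsion p) p)
    (S₀ : Finset (HeightOneSpectrum (𝓞 ℚ))) (hS₀ : ∀ v ∈ S₀, ((p : ℕ) : 𝓞 ℚ) ∉ v.asIdeal)
    (hSel : W.selmerInfty κ =
      datumSelmerInfty κ (W.geomPrimaryTorsion p) Lf (∅ : Set (HeightOneSpectrum (𝓞 ℚ))))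
    (hNP : nonPrimitiveSelmerInfty W κ (↑S₀ : Set (HeightOneSpectrum (𝓞 ℚ))) =
      datumSelmerInfty κ (W.geomPrimaryTorsion p) Lf (↑S₀ : Set (HeightOneSpectrum (𝓞 ℚ))))
    (D : W.SelmerDualData κ γ) [Module.Finite (IwasawaAlgebra p) D.X] (hD : D.IsTorsion)
    (DS : NonPrimitiveDualData W κ γ (↑S₀ : Set (HeightOneSpectrum (𝓞 ℚ)))) :
    Module.Finite (IwasawaAlgebra p) DS.X ∧ Module.IsTorsion (IwasawaAlgebra p) DS.X ∧
      muInvariant p DS.X = muInvariant p D.X ∧ lambdaInvariant p D.X ≤ lambdaInvariant p DS.X := by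
  obtain ⟨X, ⟨eX⟩⟩ := exists_datumDualData_of_selmerDualData Lf hSel D
  obtain ⟨X₀, ⟨e₀⟩⟩ := exists_datumDualData_of_nonPrimitiveDualData Lf _ hNP DS
  haveI : Module.Finite (IwasawaAlgebra p) X.X := Module.Finite.equiv eX.symm
  have hXt : Module.IsTorsion (IwasawaAlgebra p) X.X := (IwasawaDual.isTorsion_congr eX).2 hD
  obtain ⟨hfg, htor, hμ, hlam⟩ :=
    datumSelmer_nonPrimitive_moduleFinite_isTorsion_mu_eq_of_isCyclotomic W κ hκ hγ Lf S₀ hS₀ X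
      hXt X₀
  haveI : Module.Finite (IwasawaAlgebra p) X₀.X := hfg
  refine ⟨Module.Finite.equiv e₀, (IwasawaDual.isTorsion_congr e₀).1 htor, ?_, ?_⟩
  · rw [← muInvariant_eq_of_linearEquiv e₀, hμ, muInvariant_eq_of_linearEquiv eX]
  · rw [← lambdaInvariant_eq_of_linearEquiv e₀, ← lambdaInvariant_eq_of_linearEquiv eX]
    exact hlam

end Summit.BirchSwinnertonDyer.Rank1Residual.Additive

end
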